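import Literature.Analysis.ValidatedNumerics.TaylorModelSinCos
import Mathlib.Analysis.SpecialFunctions.Integrals.Basic
import HarnessLib

/-!
# Taylor models of `arctan ∘ g` for a Taylor-modelled `g` (the arctangent intrinsic around the centre value)

Trunk T-ANA (Analysis/ValidatedNumerics); namespace `Literature.Analysis.ValidatedNumerics.PolyMP`.
Sequel of `TaylorModelLog.lean` (`log ∘ g`, `exp ∘ g`) and `TaylorModelSinCos.lean` (`sin ∘ g`, `cos ∘ g`) in the same
Makino–Berz / Joldeş `TMComp` form "split off the constant part, expand the basic function around it": for a Taylor
model `G` of `g` on `|ρ| ≤ h` with rational midpoint `c = mid0 S G` of its constant coefficient and `u = g − c`,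

  `arctan g = arctan c + Σ_{1 ≤ n ≤ K} a_n(c) uⁿ + R_K`,   `|R_K| ≤ |u|^{K+1}/(K+1)`,

where

* the TAYLOR COEFFICIENTS `a_n(c) = arctan⁽ⁿ⁾(c)/n! = (−1)^{n−1} q_n(c) / (n (1+c²)ⁿ)` are exact rationals: `q_n(c)`
  is the imaginary part of `(c + i)ⁿ`, computed together with the real part `p_n(c)` by the first-order recurrence
  `(p, q) ↦ (p c − q, p + q c)` (`cipow`) — the linear recurrence of the Taylor coefficients of the D-finite basic
  function `arctan` (`(1+x²) y″ + 2x y′ = 0`);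
* the REMAINDER comes in integral form from the exact partial-fraction identity
  `1/(1+(c+s)²) = Σ_{n<K} (−1)ⁿ q_{n+1} sⁿ/(1+c²)^{n+1} + (−1)^K s^K (q_{K+1} + s q_K)/((1+c²)^K (1+(c+s)²))`
  (`inv_one_add_sq_expand`, induction on `K`), whose last term is at most `|s|^K` in absolute value because
  `(q_{K+1} + s q_K)² + (p_{K+1} + s p_K)² = (1+c²)^K (1+(c+s)²)` (`cipow_sq_add_sq`), integrated over `s ∈ [0, u]`
  against `arctan (c+u) − arctan c = ∫₀ᵘ ds/(1+(c+s)²)` (`abs_arctan_sub_taylor_le`; valid for EVERY real `u`, no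
  acceptance condition on the range of `u` is needed for soundness);
* the POINT VALUE `arctan c ∈ MI.arctan S Ka (MI.pi S Ka) (ofRat S c)` is the multi-precision interval arctangent of
  `IntervalLogArctan.lean` (argument reductions through an enclosure of `π` by Machin's formula, `MI.pi`, `Ka` series
  terms for both);
* `tatanCompI S h D K c U` (`tmem_atanComp`) is the Horner evaluation `U · Σ a_{n+1} Uⁿ` in Taylor-model arithmetic
  with the remainder `⌈S (B/S)^{K+1}/(K+1)⌉` folded into the constant coefficient (`|u|·S ≤ B = tabsI S h U`), and
  `tatanTM S h D K Ka G` returns the model of `arctan ∘ g` with its ACCEPTANCE FLAG (point evaluations succeeded):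
  `tmem_atan_of_tatanTM`.

Problem-independent plumbing for kernel-checked integral certificates with arctangents in the integrand; no facts,
no axioms.

## References

* M. Joldeş, *Rigorous Polynomial Approximations and Applications*, PhD thesis, ENS Lyon (2011): Section 1.4
  (Taylor coefficients of the basic functions — `arctan` among them — by recurrence relations; D-finite functions,
  thesis pp. 37–38), Section 2.2.1 (Taylor models of basic functions: coefficients and Taylor–Lagrange remainder,
  thesis pp. 51–52) and Algorithm 2.2.8 `TMComp` (composition of a Taylor model with a basic function around the
  constant coefficient, thesis p. 60). [cite: Joldes2011, Section 2.2.1]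
* K. Makino, M. Berz, *Taylor models and other validated functional inclusion methods*, Int. J. Pure Appl.
  Math. 4 (2003) 379–456 (Taylor-model intrinsics by expansion around the constant part). [cite: MakinoBerz2003, passim]
* The partial-fraction / geometric-sum identity behind the integral remainder and `arctan b − arctan a = ∫ₐᵇ (1+x²)⁻¹`
  (Mathlib `integral_inv_one_add_sq`). [folklore]
-/

open MeasureTheory intervalIntegral Set

namespace Literature.Analysis.ValidatedNumerics

namespace PolyMP

open Literature.Analysis.ValidatedNumerics.NumericsMP
open Literature.Analysis.ValidatedNumerics.ExpPoly (Poly)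

/-! ### The real and imaginary parts of `(c + i)ⁿ` -/

/-- `cipow c n = (pₙ, qₙ)` with `pₙ + i qₙ = (c + i)ⁿ`, by the recurrence `(p, q) ↦ (p c − q, p + q c)` (over any
ring; used at `ℚ` by the kernel and at `ℝ` in the proofs). [cite: Joldes2011, Section 1.4] -/
def cipow {α : Type*} [Mul α] [Add α] [Sub α] [Zero α] [One α] (c : α) : ℕ → α × α
  | 0 => (1, 0)
  | n + 1 =>
      let p := cipow c n
      (p.1 * c - p.2, p.1 + p.2 * c)

/-- [cite: Joldes2011, Section 1.4] -/
theorem cipow_zero {α : Type*} [Mul α] [Add α] [Sub α] [Zero α] [One α] (c : α) : cipow c 0 = (1, 0) := rfl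

/-- [cite: Joldes2011, Section 1.4] -/
theorem cipow_succ {α : Type*} [Mul α] [Add α] [Sub α] [Zero α] [One α] (c : α) (n : ℕ) :
    cipow c (n + 1) = ((cipow c n).1 * c - (cipow c n).2, (cipow c n).1 + (cipow c n).2 * c) := rfl

/-- The rational recurrence casts to the real one. [cite: Joldes2011, Section 1.4] -/
theorem cipow_cast (c : ℚ) : ∀ n : ℕ,
    (((cipow c n).1 : ℚ) : ℝ) = (cipow (c : ℝ) n).1 ∧ (((cipow c n).2 : ℚ) : ℝ) = (cipow (c : ℝ) n).2
  | 0 => by simp [cipow_zero]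
  | n + 1 => by
      obtain ⟨h1, h2⟩ := cipow_cast c n
      simp only [cipow_succ]
      push_cast
      rw [h1, h2]
      exact ⟨rfl, rfl⟩

/-- `pₙ² + qₙ² = (1 + c²)ⁿ` (`|c + i|² = 1 + c²`). [cite: Joldes2011, Section 1.4] -/
theorem cipow_sq_add_sq (c : ℝ) : ∀ n : ℕ, (cipow c n).1 ^ 2 + (cipow c n).2 ^ 2 = (1 + c ^ 2) ^ n
  | 0 => by simp [cipow_zero]
  | n + 1 => by
      rw [pow_succ (1 + c ^ 2) n, ← cipow_sq_add_sq c n, cipow_succ]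
      ring

/-! ### The Taylor expansion of `arctan` around `c` with integral remainder -/

/-- **Partial-fraction expansion of `1/(1+(c+s)²)` in powers of `s`** with explicit last term:
`1/(1+(c+s)²) = Σ_{n<K} (−1)ⁿ q_{n+1} sⁿ/(1+c²)^{n+1} + (−1)^K s^K (q_{K+1} + s q_K)/((1+c²)^K (1+(c+s)²))`.
[cite: Joldes2011, Section 1.4] -/
theorem inv_one_add_sq_expand (c s : ℝ) : ∀ K : ℕ,
    (1 + (c + s) ^ 2)⁻¹ =
      (∑ n ∈ Finset.range K, (-1 : ℝ) ^ n * (cipow c (n + 1)).2 / (1 + c ^ 2) ^ (n + 1) * s ^ n) +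
        (-1 : ℝ) ^ K * s ^ K * ((cipow c (K + 1)).2 + s * (cipow c K).2) /
          ((1 + c ^ 2) ^ K * (1 + (c + s) ^ 2))
  | 0 => by
      have h2 : (1 + (c + s) ^ 2) ≠ 0 := by positivity
      simp [cipow_succ, cipow_zero]
  | K + 1 => by
      rw [inv_one_add_sq_expand c s K, Finset.sum_range_succ, add_assoc]
      congr 1
      have h1 : (1 + c ^ 2) ≠ 0 := by positivity
      have h2 : (1 + (c + s) ^ 2) ≠ 0 := by positivity
      simp only [cipow_succ]
      set P := (cipow c K).1
      set Q := (cipow c K).2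
      field_simp
      ring

/-- The last term of `inv_one_add_sq_expand` is at most `|s|^K` in absolute value
(`(q_{K+1} + s q_K)² ≤ (1+c²)^K (1+(c+s)²)`, a quantity `≥ 1`). [cite: Joldes2011, Section 2.2.1] -/
theorem abs_inv_one_add_sq_rem_le (c s : ℝ) (K : ℕ) :
    |(-1 : ℝ) ^ K * s ^ K * ((cipow c (K + 1)).2 + s * (cipow c K).2) /
        ((1 + c ^ 2) ^ K * (1 + (c + s) ^ 2))| ≤ |s| ^ K := by
  simp only [cipow_succ]
  set P := (cipow c K).1 with hP
  set Q := (cipow c K).2 with hQ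
  have hPQ : P ^ 2 + Q ^ 2 = (1 + c ^ 2) ^ K := cipow_sq_add_sq c K
  set M := (1 + c ^ 2) ^ K * (1 + (c + s) ^ 2) with hM
  have hM1 : 1 ≤ M := by
    have h1 : (1 : ℝ) ≤ (1 + c ^ 2) ^ K := one_le_pow₀ (by nlinarith [sq_nonneg c])
    have h2 : (1 : ℝ) ≤ 1 + (c + s) ^ 2 := by nlinarith [sq_nonneg (c + s)]
    nlinarith
  have hM0 : 0 < M := lt_of_lt_of_le one_pos hM1
  have hA2 : (P + Q * c + s * Q) ^ 2 ≤ M := by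
    have e : (P + Q * c + s * Q) ^ 2 + (P * (c + s) - Q) ^ 2 = M := by
      rw [hM, ← hPQ]; ring
    nlinarith [sq_nonneg (P * (c + s) - Q)]
  have hA : |P + Q * c + s * Q| ≤ M := by
    rw [abs_le]
    constructor
    · nlinarith [sq_nonneg (P + Q * c + s * Q + M)]
    · nlinarith [sq_nonneg (P + Q * c + s * Q - M)]
  rw [abs_div, abs_mul, abs_mul, abs_pow, abs_pow, abs_neg, abs_one, one_pow, one_mul, abs_of_pos hM0,
    div_le_iff₀ hM0]
  calc |s| ^ K * |P + Q * c + s * Q| ≤ |s| ^ K * M :=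
        mul_le_mul_of_nonneg_left hA (pow_nonneg (abs_nonneg s) K)
    _ = |s| ^ K * M := rfl

/-- The Taylor coefficient of `u^{n+1}` in `arctan (c+u)`: `a_{n+1}(c) = (−1)ⁿ q_{n+1}(c)/((n+1)(1+c²)^{n+1})`
(`= arctan⁽ⁿ⁺¹⁾(c)/(n+1)!`). [cite: Joldes2011, Section 1.4] -/
noncomputable def atanCoeffR (c : ℝ) (n : ℕ) : ℝ :=
  (-1 : ℝ) ^ n * (cipow c (n + 1)).2 / ((1 + c ^ 2) ^ (n + 1) * ((n : ℝ) + 1))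

/-- **Taylor expansion of `arctan` around `c` with remainder**: for EVERY real `c`, `u` and `K`,
`|arctan (c+u) − arctan c − Σ_{n<K} a_{n+1}(c) u^{n+1}| ≤ |u|^{K+1}/(K+1)` (integral form of the remainder:
`arctan (c+u) − arctan c = ∫₀ᵘ ds/(1+(c+s)²)`, the expansion `inv_one_add_sq_expand` integrated termwise, its last
term bounded by `|s|^K`). [cite: Joldes2011, Section 2.2.1] -/
theorem abs_arctan_sub_taylor_le (c u : ℝ) (K : ℕ) :
    |Real.arctan (c + u) - Real.arctan c - ∑ n ∈ Finset.range K, atanCoeffR c n * u ^ (n + 1)| ≤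
      |u| ^ (K + 1) / (K + 1) := by
  -- the remainder integrand and the polynomial part
  set R : ℝ → ℝ := fun s => (-1 : ℝ) ^ K * s ^ K * ((cipow c (K + 1)).2 + s * (cipow c K).2) /
    ((1 + c ^ 2) ^ K * (1 + (c + s) ^ 2)) with hR
  set α : ℕ → ℝ := fun n => (-1 : ℝ) ^ n * (cipow c (n + 1)).2 / (1 + c ^ 2) ^ (n + 1) with hα
  have hRc : Continuous R := by
    rw [hR]
    refine Continuous.div (by fun_prop) (by fun_prop) fun s => ?_
    positivity
  -- `arctan (c+u) − arctan c = ∫₀ᵘ (1+(c+s)²)⁻¹ ds`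
  have hint : ∫ s in (0 : ℝ)..u, (1 + (c + s) ^ 2)⁻¹ = Real.arctan (c + u) - Real.arctan c := by
    rw [intervalIntegral.integral_comp_add_left (fun x : ℝ => (1 + x ^ 2)⁻¹) c, integral_inv_one_add_sq, add_zero]
  -- expand the integrand
  have hexp : (fun s : ℝ => (1 + (c + s) ^ 2)⁻¹) = fun s => (∑ n ∈ Finset.range K, α n * s ^ n) + R s := by
    funext s
    rw [inv_one_add_sq_expand c s K]
  have hpoly : ∀ n ∈ Finset.range K, IntervalIntegrable (fun s : ℝ => α n * s ^ n) volume 0 u :=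
    fun n _ => (continuous_const.mul (continuous_pow n)).intervalIntegrable _ _
  have hsum : IntervalIntegrable (fun s : ℝ => ∑ n ∈ Finset.range K, α n * s ^ n) volume 0 u :=
    (continuous_finsetSum _ fun n _ => continuous_const.mul (continuous_pow n)).intervalIntegrable _ _
  have hRi : IntervalIntegrable R volume 0 u := hRc.intervalIntegrable _ _
  rw [hexp, intervalIntegral.integral_add hsum hRi, intervalIntegral.integral_finsetSum hpoly] at hint
  have hterm : ∀ n ∈ Finset.range K, ∫ s in (0 : ℝ)..u, α n * s ^ n = atanCoeffR c n * u ^ (n + 1) := by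
    intro n _
    rw [intervalIntegral.integral_const_mul, integral_pow, hα, atanCoeffR]
    have hn : ((n : ℝ) + 1) ≠ 0 := by positivity
    have h1 : (1 + c ^ 2) ^ (n + 1) ≠ 0 := by positivity
    field_simp
    ring
  rw [Finset.sum_congr rfl hterm] at hint
  have key : Real.arctan (c + u) - Real.arctan c - ∑ n ∈ Finset.range K, atanCoeffR c n * u ^ (n + 1) =
      ∫ s in (0 : ℝ)..u, R s := by
    linarith
  rw [key]
  -- bound the remainder integral
  have hg : IntegrableOn (fun s : ℝ => |s - 0| ^ K) (uIoc 0 u) volume :=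
    intervalIntegrable_iff.mp (((continuous_id.sub continuous_const).abs.pow K).intervalIntegrable 0 u)
  have hle : ∀ᵐ s ∂(volume.restrict (uIoc (0 : ℝ) u)), ‖R s‖ ≤ |s - 0| ^ K :=
    Filter.Eventually.of_forall fun s => by
      rw [Real.norm_eq_abs, sub_zero, hR]
      exact abs_inv_one_add_sq_rem_le c s K
  calc |∫ s in (0 : ℝ)..u, R s| = ‖∫ s in uIoc (0 : ℝ) u, R s‖ := by
        rw [← Real.norm_eq_abs, intervalIntegral.norm_intervalIntegral_eq]
    _ ≤ ∫ s in uIoc (0 : ℝ) u, |s - 0| ^ K := norm_integral_le_of_norm_le hg hle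
    _ = |u - 0| ^ (K + 1) / (K + 1) := integral_pow_abs_sub_uIoc K
    _ = |u| ^ (K + 1) / (K + 1) := by rw [sub_zero]

/-! ### `arctan (c + u) − arctan c` for a Taylor-modelled `u` -/

/-- The rational Taylor coefficients `a_1(c), …, a_K(c)` of `arctan (c+u) − arctan c = Σ a_n uⁿ + R_K` as a
coefficient list (entry `n` is `a_{n+1}`). [cite: Joldes2011, Section 2.2.1] -/
def atanCoeffs (c : ℚ) (K : ℕ) : List ℚ :=
  (List.range K).map fun n : ℕ => (-1 : ℚ) ^ n * (cipow c (n + 1)).2 / ((1 + c ^ 2) ^ (n + 1) * ((n : ℚ) + 1))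

/-- `u · Poly.eval (atanCoeffs c K) u = Σ_{n<K} a_{n+1}(c) u^{n+1}`. [folklore] -/
private theorem mul_eval_atanCoeffs (c : ℚ) (K : ℕ) (u : ℝ) :
    u * Poly.eval (atanCoeffs c K) u = ∑ n ∈ Finset.range K, atanCoeffR (c : ℝ) n * u ^ (n + 1) := by
  rw [atanCoeffs, poly_eval_map_range, Finset.mul_sum]
  refine Finset.sum_congr rfl fun n _ => ?_
  rw [atanCoeffR, ← (cipow_cast c (n + 1)).2, pow_succ]
  push_cast
  ring

/-- Scaled remainder bound `⌈S (B/S)^{K+1}/(K+1)⌉` from a scaled range bound `B` (`|u| S ≤ B`). [folklore] -/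
def tatanCompRem (S : ℕ) (B : ℤ) (K : ℕ) : ℤ :=
  ⌈(S : ℚ) * (((B : ℚ) / S) ^ (K + 1) / ((K : ℚ) + 1))⌉

/-- The Taylor model of `ρ ↦ arctan (c + u ρ) − arctan c`: `U ·` Horner on `atanCoeffs c K` at `U`, plus the
remainder. [cite: Joldes2011, Section 2.2.1] -/
def tatanCompI (S : ℕ) (h : ℚ) (D K : ℕ) (c : ℚ) (U : IPoly) : IPoly :=
  widen0 (tmulI S h D U (thornerI S h D (atanCoeffs c K) U)) (tatanCompRem S (tabsI S h U) K)

/-- The scaled remainder estimate of `tmem_atanComp`. [folklore] -/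
private theorem atan_rem_scaled {S : ℕ} (hS : 0 < S) {B : ℤ} {K : ℕ} {u r : ℝ} (huB : |u| ≤ (B : ℝ) / S)
    (hr : |r| ≤ |u| ^ (K + 1) / (K + 1)) : |r| * S ≤ (tatanCompRem S B K : ℝ) := by
  have hSr : (0 : ℝ) < S := by exact_mod_cast hS
  have h2 : |u| ^ (K + 1) ≤ ((B : ℝ) / S) ^ (K + 1) := pow_le_pow_left₀ (abs_nonneg _) huB _
  have hK : (0 : ℝ) < (K : ℝ) + 1 := by positivity
  have h3 : |r| ≤ ((B : ℝ) / S) ^ (K + 1) / ((K : ℝ) + 1) := hr.trans (div_le_div_of_nonneg_right h2 hK.le)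
  have h4 : ((S : ℚ) * ((((B : ℚ) / S) ^ (K + 1)) / ((K : ℚ) + 1)) : ℝ) ≤ (tatanCompRem S B K : ℝ) := by
    unfold tatanCompRem; exact_mod_cast Int.le_ceil _
  refine le_trans ?_ h4
  push_cast
  rw [mul_comm ((S : ℕ) : ℝ)]
  exact mul_le_mul_of_nonneg_right h3 hSr.le

/-- **Soundness of `tatanCompI`** (no range condition: the remainder bound holds for every `u`).
[cite: Joldes2011, Section 2.2.1] -/
theorem tmem_atanComp {S : ℕ} (hS : 0 < S) {h : ℚ} (h0 : 0 ≤ h) (D K : ℕ) (c : ℚ) {u : ℝ → ℝ} {U : IPoly}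
    (hu : TMem S h u U) :
    TMem S h (fun ρ => Real.arctan ((c : ℝ) + u ρ) - Real.arctan (c : ℝ)) (tatanCompI S h D K c U) := by
  intro ρ hρ
  have hP := tmem_mul hS h0 D hu (tmem_horner hS h0 D hu (atanCoeffs c K))
  obtain ⟨as, has, hev⟩ := hP ρ hρ
  have hSr : (0 : ℝ) < S := by exact_mod_cast hS
  have habs := abs_le_tabsI h0 hu hρ
  have huB : |u ρ| ≤ ((tabsI S h U : ℤ) : ℝ) / S := by rw [le_div_iff₀ hSr]; exact habs
  have hrem := abs_arctan_sub_taylor_le (c : ℝ) (u ρ) K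
  rw [← mul_eval_atanCoeffs] at hrem
  have hδle := atan_rem_scaled hS huB hrem
  obtain ⟨bs, hbs, hev2⟩ := exists_widen0 has hδle ρ
  refine ⟨bs, hbs, ?_⟩
  rw [hev2, ← hev]
  ring

/-! ### `arctan ∘ g` -/

/-- The point value `arctan c` of the rational centre `c`: the interval arctangent `MI.arctan` of
`IntervalLogArctan.lean` at the thin interval `ofRat S c`, its argument reductions fed with Machin's enclosure
`MI.pi S Ka` of `π` (`Ka` series terms for both; `none` if either evaluation is refused) — the point-evaluation step
`f(c)` of `TMComp`. [cite: Joldes2011, Algorithm 2.2.8] -/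
def tatanPt (S Ka : ℕ) (c : ℚ) : Option MI :=
  match MI.pi S Ka with
  | none => none
  | some P => MI.arctan S Ka P (ofRat S c)

/-- Soundness of `tatanPt`: `arctan c ∈ tatanPt S Ka c`. [cite: Joldes2011, Algorithm 2.2.8] -/
theorem mem_tatanPt {S : ℕ} (hS : 0 < S) {Ka : ℕ} {c : ℚ} {A : MI} (h : tatanPt S Ka c = some A) :
    MI.mem S (Real.arctan (c : ℝ)) A := by
  unfold tatanPt at h
  rcases hP : MI.pi S Ka with _ | P
  · simp [hP] at h
  · simp only [hP] at h
    exact MI.mem_arctan hS (MI.mem_pi S hP) h (mem_ofRat S c)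

/-- The Taylor model of `arctan ∘ g` together with its acceptance flag: `c = mid0 S G`, `u = g − c`,
`arctan g = arctan c + (arctan (c+u) − arctan c)`, `arctan c ∈ tatanPt S Ka c` (accepted iff the point evaluation
succeeds; the expansion itself needs no range condition). [cite: Joldes2011, Algorithm 2.2.8] -/
def tatanTM (S : ℕ) (h : ℚ) (D K Ka : ℕ) (G : IPoly) : IPoly × Bool :=
  match tatanPt S Ka (mid0 S G) with
  | none => ([], false)
  | some A => (taddI (tconst A) (tatanCompI S h D K (mid0 S G) (tcentre S G)), true)

/-- **Soundness of `tatanTM`.** [cite: Joldes2011, Algorithm 2.2.8] -/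
theorem tmem_atan_of_tatanTM {S : ℕ} (hS : 0 < S) {h : ℚ} (h0 : 0 ≤ h) {D K Ka : ℕ} {g : ℝ → ℝ} {G : IPoly}
    (hg : TMem S h g G) (hok : (tatanTM S h D K Ka G).2 = true) :
    TMem S h (fun ρ => Real.arctan (g ρ)) (tatanTM S h D K Ka G).1 := by
  unfold tatanTM at hok ⊢
  rcases hA : tatanPt S Ka (mid0 S G) with _ | A
  · simp only [hA] at hok; exact absurd hok Bool.false_ne_true
  · simp only [hA] at hok ⊢
    clear hok
    have hatan := mem_tatanPt hS hA
    have hU := tmem_centre hg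
    have hsum := tmem_add (tmem_const (h := h) hatan) (tmem_atanComp hS h0 D K (mid0 S G) hU)
    intro ρ hρ
    obtain ⟨as, has, hev⟩ := hsum ρ hρ
    refine ⟨as, has, ?_⟩
    rw [← hev]
    show Real.arctan (g ρ) = Real.arctan ((mid0 S G : ℚ) : ℝ) +
      (Real.arctan (((mid0 S G : ℚ) : ℝ) + (g ρ - ((mid0 S G : ℚ) : ℝ))) - Real.arctan ((mid0 S G : ℚ) : ℝ))
    rw [add_sub_cancel, add_sub_cancel]

end PolyMP

end Literature.Analysis.ValidatedNumerics
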